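import Mathlib.Data.Nat.Factorial.DoubleFactorial
import Mathlib.Tactic.NormNum
import HarnessLib

/-!
# AHKN 2006 — the number of independent 1PI q-type (no-lepton-loop self-energy-like) diagrams `N_n` for `n ≤ 7` loops, and the printed recursion

independent recomputation; certified where stated, statistical where stated; no new-physics claim.

CITATION HEADER (venture `QEDPrecision`, cell `pub-qed`; a typed PUBLISHED combinatorial table + the printed recursion; kernel evaluation
(`decide`) of integer counts only — no physics, no numerics).

Source: T. Aoyama, M. Hayakawa, T. Kinoshita, M. Nio, "Automated calculation scheme for αⁿ contributions of QED to lepton g−2: Generating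
renormalized amplitudes for diagrams without lepton loops", Nucl. Phys. B 740 (2006) 138–180 = arXiv:hep-ph/0512288 [AoyamaEtAl2006], §2
("q-type diagrams"), subsection "Number of diagrams" (e-print file `qdiag.tex` l.211–262; the table is `\label{table:num_s-t_EC}`, split out by
the cell as `table_num_s-t_EC.tex`; cell copies HOME `data/lit/sources/.cache/hep-ph_0512288/`). VERBATIM: "Based on the above consideration,
the number of 1PI q-type diagrams 𝒩_n of n loops is given recursively by the following relation (disregarding time-reversal symmetry):
  𝒩_n = (2n−1)!! − Σ_{(k_1,…,k_m) ∈ 𝔓_n} Π_j 𝒩_{k_j} ,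
where 𝔓_n denotes the set of ordered partitions of n (i.e. (1,2) and (2,1) should be distinguished). Table [num_s-t_EC] shows the number
N_n of independent q-type diagrams for n ≤ 7 as well as that of symmetric ones and that of asymmetric ones under time-reversal.
(𝒩_n = N_n^sym + 2 N_n^asym.)" — TABLE (caption "The number of independent 1PI diagrams of q-type, N_n, with n loops."):
  n | N_n | N_n^sym | N_n^asym :  1 | 1 | 1 | 0 · 2 | 2 | 2 | 0 · 3 | 8 | 6 | 2 · 4 | 47 | 20 | 27 · 5 | 389 | 72 | 317 · 6 | 4226 | 290 | 3936 ·
  7 | 55804 | 1198 | 54606 — "It also demonstrates that the incorporation of time-reversal symmetry efficiently reduces the number of independent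
diagrams to be evaluated (N_n^sym + N_n^asym) at higher orders." (A q-type diagram of n loops = one open lepton line with 2n vertices and n photons,
one-particle irreducible; §2 fixes the representative under time reversal by the lexicographic rule quoted at l.200–207.)

What is typed and certified (kernel, `decide`; lists of ≤ 7 naturals — the sum over ordered partitions is evaluated literally over the
2ⁿ⁻¹ − 1 compositions of n with at least two parts, the one-part partition (n) being 𝒩_n itself):
* `CountRow`, `table1` — the seven printed rows VERBATIM; `table1_N_eq_sym_add_asym` — in every row `N_n = N_n^sym + N_n^asym`.
* `compositions n` (ordered partitions of n into positive parts), `calNList` / `calN` — THE PRINTED RECURSION, evaluated bottom-up;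
  `calN_values : [𝒩_1, …, 𝒩_7] = [1, 2, 10, 74, 706, 8162, 110410]`.
* `table1_calN` — the printed relation `𝒩_n = N_n^sym + 2 N_n^asym` holds in all seven rows with 𝒩_n from the recursion (so the table's
  sym/asym split is consistent with the recursion row by row; the sym column itself — the time-reversal-symmetric count — is not determined by
  the recursion and is not re-derived here).
* `compositions_card` — sanity of the enumeration: `|compositions n| = 2ⁿ⁻¹` for n = 1…7.
The cell's own censuses of the same objects (exhaustive enumeration through n = 5 and the Touchard / Burns–Muche double-occurrence-word
recurrences through n = 7) live Summits-side in `Summits/Ventures/QEDPrecision/Diagrams/` (`NoLoopVertexGraphs`, `SetVWordRecurrences`: families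
`1, 2, 8, 47, 389, 4226, 55804`, symmetric `1, 2, 6, 20, 72, 290, 1198`, directed `1, 2, 10, 74, 706, 8162, 110410`) and name this table only in
comments; this file is the typed PRINT side they can be compared with (Literature does not import Summits).
-/

namespace Literature.MathematicalPhysics.QuantumFieldTheory.AoyamaEtAl2006

/-- One row of the table: loop number `n`, `N_n` (independent q-type diagrams), `N_n^sym` (time-reversal symmetric), `N_n^asym`
(asymmetric, one representative per time-reversal pair) [cite: AoyamaEtAl2006, §2 Table `num_s-t_EC`]. -/
structure CountRow where
  /-- number of loops (= photons) `n`. -/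
  n : ℕ
  /-- `N_n`. -/
  N : ℕ
  /-- `N_n^sym`. -/
  sym : ℕ
  /-- `N_n^asym`. -/
  asym : ℕ
  deriving DecidableEq

/-- The seven printed rows, VERBATIM [cite: AoyamaEtAl2006, §2 Table `num_s-t_EC` (e-print `qdiag.tex` l.244–250)]. -/
def table1 : List CountRow :=
  [⟨1, 1, 1, 0⟩, ⟨2, 2, 2, 0⟩, ⟨3, 8, 6, 2⟩, ⟨4, 47, 20, 27⟩, ⟨5, 389, 72, 317⟩, ⟨6, 4226, 290, 3936⟩, ⟨7, 55804, 1198, 54606⟩]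

/-- In every printed row `N_n = N_n^sym + N_n^asym` ("the number of independent diagrams to be evaluated (N_n^sym + N_n^asym)").
[cite: AoyamaEtAl2006, §2, sentence after Table `num_s-t_EC`] -/
theorem table1_N_eq_sym_add_asym : (table1.all fun r => r.N == r.sym + r.asym) = true := by decide +kernel

/-- All ordered partitions (compositions) into positive parts of `0, 1, …, n`, built bottom-up: entry `m` of `compTable n` is the list of
compositions of `m` (a composition of `m + 1` = a first part `j + 1`, `0 ≤ j ≤ m`, followed by a composition of `m − j`). Plumbing for the
printed recursion; structural recursion so that the kernel evaluates it. [folklore] -/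
def compTable : ℕ → List (List (List ℕ))
  | 0 => [[[]]]
  | n + 1 =>
    let t := compTable n
    t ++ [(List.range (n + 1)).flatMap fun j => (t.getD (n - j) []).map fun c => (j + 1) :: c]

/-- Ordered partitions (compositions) of `n` into positive parts, as lists: `compositions 3 = [[1,1,1], [1,2], [2,1], [3]]` up to order of
enumeration (plumbing for the printed `𝔓_n`). [folklore] -/
def compositions (n : ℕ) : List (List ℕ) := (compTable n).getD n []

/-- Sanity of the enumeration (private helper): `|compositions n| = 2^(n-1)` for `n = 1 … 7`. [folklore] -/
private theorem compositions_card : ((List.range 7).map fun i => (compositions (i + 1)).length) = [1, 2, 4, 8, 16, 32, 64] := by decide +kernel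

/-- `[𝒩_1, …, 𝒩_n]` by THE PRINTED RECURSION `𝒩_n = (2n−1)!! − Σ_{(k_1,…,k_m) ∈ 𝔓_n, m ≥ 2} Π_j 𝒩_{k_j}` (the one-part ordered partition `(n)`
contributes `𝒩_n` itself and is what the relation solves for), built bottom-up: entry `i` of the list is `𝒩_{i+1}`
[cite: AoyamaEtAl2006, §2 eq. for 𝒩_n (e-print `qdiag.tex` l.217–221)]. -/
def calNList : ℕ → List ℕ
  | 0 => []
  | n + 1 =>
    let prev := calNList n
    prev ++ [Nat.doubleFactorial (2 * (n + 1) - 1)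
      - (((compositions (n + 1)).filter fun c => 2 ≤ c.length).map fun c => (c.map fun k => prev.getD (k - 1) 0).prod).sum]

/-- `𝒩_n` (1PI q-type diagrams of `n` loops, time reversal disregarded) by the printed recursion. [cite: AoyamaEtAl2006, §2] -/
def calN (n : ℕ) : ℕ := (calNList n).getD (n - 1) 0

/-- The recursion evaluated: `𝒩_1 … 𝒩_7 = 1, 2, 10, 74, 706, 8162, 110410` (kernel `decide`). [cite: AoyamaEtAl2006, §2] -/
theorem calN_values : calNList 7 = [1, 2, 10, 74, 706, 8162, 110410] := by decide +kernel

/-- THE TABLE vs THE RECURSION: the printed relation `𝒩_n = N_n^sym + 2 N_n^asym` holds in all seven rows with `𝒩_n` computed from the printed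
recursion — `1 = 1 + 0`, `2 = 2 + 0`, `10 = 6 + 2·2`, `74 = 20 + 2·27`, `706 = 72 + 2·317`, `8162 = 290 + 2·3936`, `110410 = 1198 + 2·54606`.
[cite: AoyamaEtAl2006, §2, "(𝒩_n = N_n^sym + 2 N_n^asym.)" and Table `num_s-t_EC`] -/
theorem table1_calN : (table1.all fun r => calN r.n == r.sym + 2 * r.asym) = true := by decide +kernel

/-- Equivalently, per row, `N_n = 𝒩_n − N_n^asym` and `N_n = (𝒩_n + N_n^sym) / 2` (the count "up to time reversal"); in particular the
fourth- and fifth-loop rows give the `47` eighth-order and `389` tenth-order independent self-energy-like diagrams. [cite: AoyamaEtAl2006, §2] -/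
theorem table1_N_from_calN :
    (table1.all fun r => r.N == calN r.n - r.asym && 2 * r.N == calN r.n + r.sym) = true ∧
    (table1.map CountRow.N) = [1, 2, 8, 47, 389, 4226, 55804] := by
  refine ⟨by decide +kernel, by decide +kernel⟩

end Literature.MathematicalPhysics.QuantumFieldTheory.AoyamaEtAl2006
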